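import Literature.IUT.HodgeTheaters.InitialThetaData
import Literature.NumberTheory.EllipticCurves.GaloisAction
import HarnessLib

/-!
# [IUTchI] Def. 3.1 (b)(c) ⇒ `G_K` fixes `E_F[2l](F̄)`: the global premise of Example 3.2 (iv) — proofs

`Proofs` companion (theorems only; no definitions, no named facts, no instances) of
`Literature.IUT.HodgeTheaters.InitialThetaData` (abc-iut-L5-t2). S. Mochizuki, *Inter-universal
Teichmüller theory I*, kurims May-2020 manuscript, Example 3.2 (iv) p. 71: "… where we recall
that `q_v̲` denotes the `q`-parameter of the elliptic curve `E_v̲` over `K_v̲` — … it follows from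
our assumption concerning `2`-torsion [cf. Definition 3.1, (b)], together with the definition of
“`K`” [cf. Definition 3.1, (c)], that `q_v̲` admits a `2l`-th root in `𝒪^▷(T_{X̲̲_v̲}) (≅ 𝒪^▷_{K_v̲})`."
[claim: Mochizuki2012, status: disputed] — of this sentence we prove the GLOBAL half, a theorem
about the REAL data of the typing `InitialThetaData F K Fbar E l P`:

* `InitialThetaData.mem_galoisSubgroupOf_iff_fixesTorsion` — **`G_K = Ker(G_F → GL₂(𝔽_l))`**:
  an element of `G_F = Gal(F̄/F)` fixes (the image of) `K` pointwise iff it fixes the `l`-torsion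
  `E_F[l](F̄)` pointwise (Def. 3.1 (c) "`K` … the finite Galois extension of `F` determined by
  the kernel of this homomorphism", typed as the field `range_K_iff`; here the two inclusions);
* `InitialThetaData.galoisAct_eq_of_torsion_six` — every `σ ∈ G_F` fixes `E_F[6](F̄)` pointwise
  (Def. 3.1 (b) "the `2·3`-torsion points of `E_F` are rational over `F`", field
  `torsion_six_rational`, and Mathlib's `Point.map_baseChange`);
* `InitialThetaData.galoisAct_eq_of_torsion_l`, `…_of_torsion_two_mul_l` — **every `σ ∈ G_K` fixes
  `E_F[2l](F̄)` pointwise** (`l` is an odd prime, Def. 3.1 (c): Bézout `2a + lb = 1` splits a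
  `2l`-torsion point into an `l`-torsion and a `2`-torsion point);
* the TRANSPORT to the tree's Galois-module convention (`Literature.NumberTheory.EllipticCurves`'s
  `GaloisAction.lean`: `Γ_K := Field.absoluteGaloisGroup K` acting on
  `geomPoints (E.baseChange K) = E_K(K̄)`, `K̄ := AlgebraicClosure K`):
  `InitialThetaData.smul_eq_of_torsion_two_mul_l : ∀ σ : Γ_K, ∀ P ∈ E_K(K̄), (2l)·P = 0 → σ·P = P`
  (along a `K`-isomorphism `F̄ ≃ K̄`, `IsAlgClosure.equiv` — `F̄` is an algebraic closure of `K` by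
  the tower `F ⊆ K ⊆ F̄`), with the two specialisations `smul_geomTorsion_two_eq`,
  `smul_geomTorsion_l_eq` in the hypothesis shape `∀ σ (Q : geomTorsion (E.baseChange K) n), σ • Q = Q`
  consumed by `WeierstrassCurve.two_mul_dvd_ordMinimalDiscriminant_of_forall_smul_geomTorsion_eq`
  (`MultiplicativeTrivialTorsionDvdOrdProofs.lean`: `2l ∣ ord_v(q_v)` at multiplicative `v ∤ 2l`).

NOT here (named, classical, local): the decomposition group `Γ_{K_v} ↪ Γ_K` / `K̄ ↪ K̄_v` and the
Tate uniformisation `E_K ×_K K_v ≅ E_q` that turn the global statement into the `2l`-th ROOT of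
`q_v` in `K_v` (the tree's `TateCurve` files). Classical background: Silverman, *AEC* III.§7,
VIII.§1. Nothing here takes a side on [IUTchIII] Cor. 3.12; this is a kernel check of one printed
inference about the initial Θ-data. Axioms: `propext`, `Classical.choice`, `Quot.sound`.

## References

* [Mochizuki2012] S. Mochizuki, IUT I, Def. 3.1 (b)(c) pp. 61–62, Example 3.2 (iv) p. 71.
* [SilvermanAEC2009] J. H. Silverman, *The Arithmetic of Elliptic Curves*, 2nd ed., III.§7, VIII.§1.
-/

noncomputable section

open scoped Classical

namespace Literature.IUT.HodgeTheaters

open WeierstrassCurve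

universe u v w

section Global

variable {F : Type u} {K : Type v} {Fbar : Type w} [Field F] [NumberField F] [Field K]
  [NumberField K] [Algebra F K] [Field Fbar] [Algebra F Fbar] [Algebra K Fbar]
  {E : WeierstrassCurve F} [E.IsElliptic] {l : ℕ} {P : BadPlacePredicates K}
  (D : InitialThetaData F K Fbar E l P)

namespace InitialThetaData

include D

/-- The coordinates of an `l`-torsion point of `E_F(F̄)` lie in (the image of) `K = F(E_F[l])`
(Def. 3.1 (c), `range_K_iff`: an element of `F̄` fixed by every `σ ∈ G_F` acting trivially on
`E_F[l](F̄)` comes from `K`). [claim: Mochizuki2012, status: disputed] -/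
theorem coord_mem_range_of_torsion_l {x y : Fbar} (h : (E.baseChange Fbar).toAffine.Nonsingular x y)
    (hT : (l : ℤ) • (Affine.Point.some x y h : GeomPoints Fbar E) = 0) :
    x ∈ Set.range (algebraMap K Fbar) ∧ y ∈ Set.range (algebraMap K Fbar) := by
  have key : ∀ σ : Fbar ≃ₐ[F] Fbar, FixesTorsion E l σ → σ x = x ∧ σ y = y := fun σ hσ => by
    have hP := hσ _ hT
    rw [galoisAct, Affine.Point.map_some, Affine.Point.some.injEq] at hP
    exact hP
  exact ⟨(D.range_K_iff x).2 fun σ hσ => (key σ hσ).1, (D.range_K_iff y).2 fun σ hσ => (key σ hσ).2⟩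

/-- **`G_K ⊆ Ker(G_F → GL₂(𝔽_l))`, pointwise**: an element of `G_F` fixing `K` pointwise fixes every
`l`-torsion point of `E_F(F̄)` (its coordinates lie in `K`). [claim: Mochizuki2012, status: disputed] -/
theorem galoisAct_eq_of_torsion_l {σ : Fbar ≃ₐ[F] Fbar} (hσ : σ ∈ galoisSubgroupOf F K Fbar)
    {Q : GeomPoints Fbar E} (hQ : (l : ℤ) • Q = 0) : galoisAct E σ Q = Q := by
  have hσ' : ∀ z : K, σ (algebraMap K Fbar z) = algebraMap K Fbar z := hσ
  rcases Q with _ | ⟨x, y, h⟩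
  · exact map_zero _
  · obtain ⟨⟨a, ha⟩, ⟨b, hb⟩⟩ := D.coord_mem_range_of_torsion_l h hQ
    have hx : σ x = x := by rw [← ha]; exact hσ' a
    have hy : σ y = y := by rw [← hb]; exact hσ' b
    rw [galoisAct, Affine.Point.map_some, Affine.Point.some.injEq]
    exact ⟨hx, hy⟩

/-- **`G_K = Ker(G_F → GL₂(𝔽_l))`** (Def. 3.1 (c) "`K ⊆ F̄` … the finite Galois extension of `F`
determined by the kernel of this homomorphism", as typed by `range_K_iff`): `σ ∈ G_F` fixes `K`
pointwise iff it acts trivially on `E_F[l](F̄)`. [claim: Mochizuki2012, status: disputed] -/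
theorem mem_galoisSubgroupOf_iff_fixesTorsion (σ : Fbar ≃ₐ[F] Fbar) :
    σ ∈ galoisSubgroupOf F K Fbar ↔ FixesTorsion E l σ := by
  refine ⟨fun hσ Q hQ => D.galoisAct_eq_of_torsion_l hσ hQ, fun hσ => ?_⟩
  show ∀ z : K, σ (algebraMap K Fbar z) = algebraMap K Fbar z
  exact fun z => (D.range_K_iff (algebraMap K Fbar z)).1 ⟨z, rfl⟩ σ hσ

/-- **Def. 3.1 (b) "the `2·3`-torsion points of `E_F` are rational over `F`"** in Galois form:
every `σ ∈ G_F` fixes every `6`-torsion point of `E_F(F̄)` (it is the base change of an `F`-point,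
`torsion_six_rational`; Mathlib's `Point.map_baseChange`). [claim: Mochizuki2012, status: disputed] -/
theorem galoisAct_eq_of_torsion_six (σ : Fbar ≃ₐ[F] Fbar) {Q : GeomPoints Fbar E}
    (hQ : (6 : ℤ) • Q = 0) : galoisAct E σ Q = Q := by
  obtain ⟨Q₀, rfl⟩ := D.torsion_six_rational Q hQ
  rw [galoisAct]
  exact Affine.Point.map_baseChange (σ : Fbar →ₐ[F] Fbar) Q₀

/-- `l` is odd (Def. 3.1 (c): `l ≥ 5` prime), as `IsCoprime 2 l` over `ℤ`.
[claim: Mochizuki2012, status: disputed] -/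
theorem isCoprime_two_l : IsCoprime (2 : ℤ) (l : ℤ) := by
  have h5 := D.five_le_l
  have h : Nat.Coprime 2 l := (Nat.coprime_primes Nat.prime_two D.l_prime).2 (by omega)
  exact_mod_cast Nat.isCoprime_iff_coprime.2 h

/-- **The global premise of [IUTchI] Example 3.2 (iv)**: every `σ ∈ G_K` fixes every `2l`-torsion
point of `E_F(F̄)` — "it follows from our assumption concerning `2`-torsion [Def. 3.1 (b)], together
with the definition of `K` [Def. 3.1 (c)] …" (Bézout `2a + lb = 1`: a `2l`-torsion point is the
sum of an `l`-torsion point, fixed by `G_K`, and a `2`-torsion point, rational over `F`).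
[claim: Mochizuki2012, status: disputed] -/
theorem galoisAct_eq_of_torsion_two_mul_l {σ : Fbar ≃ₐ[F] Fbar} (hσ : σ ∈ galoisSubgroupOf F K Fbar)
    {Q : GeomPoints Fbar E} (hQ : ((2 * l : ℕ) : ℤ) • Q = 0) : galoisAct E σ Q = Q := by
  obtain ⟨a, b, hab⟩ := D.isCoprime_two_l
  have hQ' : ((2 : ℤ) * l) • Q = 0 := by exact_mod_cast hQ
  have h₁ : (l : ℤ) • ((a * 2) • Q) = 0 := by
    rw [smul_smul, show (l : ℤ) * (a * 2) = a * (2 * l) by ring, mul_smul, hQ', smul_zero]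
  have h₂ : (6 : ℤ) • ((b * l) • Q) = 0 := by
    rw [smul_smul, show (6 : ℤ) * (b * l) = (3 * b) * (2 * l) by ring, mul_smul, hQ', smul_zero]
  have hsplit : Q = (a * 2) • Q + (b * l) • Q := by rw [← add_smul, hab, one_smul]
  rw [hsplit, map_add, D.galoisAct_eq_of_torsion_l hσ h₁, D.galoisAct_eq_of_torsion_six σ h₂]

/-- The same for the `K`-LINEAR automorphisms of `F̄` (`Gal(F̄/K)` as `F̄ ≃ₐ[K] F̄`; restriction of
scalars to `F` lands in `G_K`). [claim: Mochizuki2012, status: disputed] -/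
theorem galoisAct_restrictScalars_eq_of_torsion_two_mul_l (τ : Fbar ≃ₐ[K] Fbar)
    {Q : GeomPoints Fbar E} (hQ : ((2 * l : ℕ) : ℤ) • Q = 0) :
    letI := D.isScalarTower
    galoisAct E (τ.restrictScalars F) Q = Q := by
  letI := D.isScalarTower
  exact D.galoisAct_eq_of_torsion_two_mul_l (σ := τ.restrictScalars F) (fun z => τ.commutes z) hQ

/-! ### Transport to `Γ_K ↷ E_K(K̄)` (the tree's `GaloisAction` convention) -/

/-- **`Γ_K` fixes `E_K[2l](K̄)` pointwise** — the global premise of [IUTchI] Example 3.2 (iv) in the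
convention of `Literature.NumberTheory.EllipticCurves` (`Field.absoluteGaloisGroup K` acting on
`geomPoints (E.baseChange K)`, `K̄ = AlgebraicClosure K`), transported from `F̄` along a
`K`-isomorphism `F̄ ≃ₐ[K] K̄` (`F̄` is an algebraic closure of `K` by the tower `F ⊆ K ⊆ F̄`;
the action is "apply `σ` to the coordinates" on both sides, `Point.map_map`/`map_injective`).
[claim: Mochizuki2012, status: disputed] -/
theorem smul_eq_of_torsion_two_mul_l (σ : Field.absoluteGaloisGroup K)
    (Pt : geomPoints (E.baseChange K)) (hPt : ((2 * l : ℕ) : ℤ) • Pt = 0) : σ • Pt = Pt := by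
  haveI := D.isAlgClosure
  haveI := D.isScalarTower
  haveI : Algebra.IsAlgebraic F Fbar := IsAlgClosure.isAlgebraic
  haveI : Algebra.IsAlgebraic K Fbar := Algebra.IsAlgebraic.tower_top (K := F) K
  haveI : IsAlgClosure K Fbar := ⟨IsAlgClosure.isAlgClosed F, inferInstance⟩
  -- a `K`-isomorphism `F̄ ≃ K̄` and the conjugate `τ := ι⁻¹ σ ι ∈ Gal(F̄/K)` of `σ`
  let ι : Fbar ≃ₐ[K] AlgebraicClosure K := IsAlgClosure.equiv K Fbar (AlgebraicClosure K)
  let σ' : AlgebraicClosure K ≃ₐ[K] AlgebraicClosure K := σ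
  let τ : Fbar ≃ₐ[K] Fbar := ι.trans (σ'.trans ι.symm)
  -- the maps on points (all as `F`-algebra maps, points of `E` over `F̄`, `K̄`)
  let ψ : AlgebraicClosure K →ₐ[F] Fbar := (ι.symm : AlgebraicClosure K →ₐ[K] Fbar).restrictScalars F
  have hsmul : σ • Pt =
      Affine.Point.map (W' := E.toAffine) ((σ' : AlgebraicClosure K →ₐ[K] AlgebraicClosure K).restrictScalars F) Pt := by
    cases Pt <;> rfl
  rw [hsmul]
  apply Affine.Point.map_injective (W' := E.toAffine) (f := ψ)
  rw [Affine.Point.map_map]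
  have hcomp : ψ.comp ((σ' : AlgebraicClosure K →ₐ[K] AlgebraicClosure K).restrictScalars F) =
      ((τ.restrictScalars F : Fbar ≃ₐ[F] Fbar) : Fbar →ₐ[F] Fbar).comp ψ := by
    ext z
    change ι.symm (σ' z) = ι.symm (σ' (ι (ι.symm z)))
    rw [AlgEquiv.apply_symm_apply]
  rw [hcomp, ← Affine.Point.map_map]
  -- `Q := ψ(Pt)` is a `2l`-torsion point of `E_F(F̄)`, fixed by `τ ∈ Gal(F̄/K)`
  have hQ : ((2 * l : ℕ) : ℤ) • Affine.Point.map (W' := E.toAffine) ψ Pt = 0 := by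
    rw [← map_zsmul]
    exact (congrArg (Affine.Point.map (W' := E.toAffine) ψ) hPt).trans (map_zero _)
  exact D.galoisAct_restrictScalars_eq_of_torsion_two_mul_l τ hQ

/-- **`Γ_K` fixes `E_K[2](K̄)` pointwise** (hypothesis `hfix2` of
`WeierstrassCurve.two_mul_dvd_ordMinimalDiscriminant_of_forall_smul_geomTorsion_eq`).
[claim: Mochizuki2012, status: disputed] -/
theorem smul_geomTorsion_two_eq (σ : Field.absoluteGaloisGroup K)
    (Q : geomTorsion (E.baseChange K) (2 : ℤ)) : σ • Q = Q := by
  apply Subtype.ext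
  rw [Literature.NumberTheory.EllipticCurves.AddSubgroup.torsionBy.coe_smul]
  refine D.smul_eq_of_torsion_two_mul_l σ (Q : geomPoints (E.baseChange K)) ?_
  have h2 : (2 : ℤ) • (Q : geomPoints (E.baseChange K)) = 0 := (Submodule.mem_torsionBy_iff _ _).1 Q.2
  rw [show ((2 * l : ℕ) : ℤ) = (l : ℤ) * 2 by push_cast; ring, mul_smul, h2, smul_zero]

/-- **`Γ_K` fixes `E_K[l](K̄)` pointwise** (hypothesis `hfixl` of
`WeierstrassCurve.two_mul_dvd_ordMinimalDiscriminant_of_forall_smul_geomTorsion_eq`).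
[claim: Mochizuki2012, status: disputed] -/
theorem smul_geomTorsion_l_eq (σ : Field.absoluteGaloisGroup K)
    (Q : geomTorsion (E.baseChange K) (l : ℤ)) : σ • Q = Q := by
  apply Subtype.ext
  rw [Literature.NumberTheory.EllipticCurves.AddSubgroup.torsionBy.coe_smul]
  refine D.smul_eq_of_torsion_two_mul_l σ (Q : geomPoints (E.baseChange K)) ?_
  have hl : (l : ℤ) • (Q : geomPoints (E.baseChange K)) = 0 := (Submodule.mem_torsionBy_iff _ _).1 Q.2
  rw [show ((2 * l : ℕ) : ℤ) = (2 : ℤ) * l by push_cast; ring, mul_smul, hl, smul_zero]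

/-! ### `E_F[2l](F̄) ⊆ E_K(K)`: the `2l`-torsion is `K`-rational -/

/-- The coordinates of a `2l`-torsion point of `E_F(F̄)` lie in (the image of) `K`: they are fixed by
`G_K` (`galoisAct_eq_of_torsion_two_mul_l`), and `G_K = Ker(G_F → GL₂(𝔽_l))` is exactly the group
whose fixed elements `range_K_iff` declares `K`-rational. [claim: Mochizuki2012, status: disputed] -/
theorem coord_mem_range_of_torsion_two_mul_l {x y : Fbar}
    (h : (E.baseChange Fbar).toAffine.Nonsingular x y)
    (hT : ((2 * l : ℕ) : ℤ) • (Affine.Point.some x y h : GeomPoints Fbar E) = 0) :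
    x ∈ Set.range (algebraMap K Fbar) ∧ y ∈ Set.range (algebraMap K Fbar) := by
  have key : ∀ σ : Fbar ≃ₐ[F] Fbar, FixesTorsion E l σ → σ x = x ∧ σ y = y := fun σ hσ => by
    have hP := D.galoisAct_eq_of_torsion_two_mul_l
      ((D.mem_galoisSubgroupOf_iff_fixesTorsion σ).2 hσ) hT
    rw [galoisAct, Affine.Point.map_some, Affine.Point.some.injEq] at hP
    exact hP
  exact ⟨(D.range_K_iff x).2 fun σ hσ => (key σ hσ).1, (D.range_K_iff y).2 fun σ hσ => (key σ hσ).2⟩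

/-- **`E_F[2l](F̄) ⊆ E_K(K)`** ([IUTchI] Ex. 3.2 (iv) p. 71, global form: "from our assumption
concerning `2`-torsion, together with the definition of `K`"): every `2l`-torsion point of `E_F(F̄)`
is the base change of a `K`-rational point of `E_K = E_F ×_F K`. [claim: Mochizuki2012, status: disputed] -/
theorem exists_baseChange_eq_of_torsion_two_mul_l (Q : GeomPoints Fbar E)
    (hQ : ((2 * l : ℕ) : ℤ) • Q = 0) :
    letI := D.isScalarTower
    ∃ Q₀ : (E.baseChange K).toAffine.Point,
      Affine.Point.baseChange (W' := E.toAffine) K Fbar Q₀ = Q := by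
  letI := D.isScalarTower
  rcases Q with _ | ⟨x, y, h⟩
  · exact ⟨0, rfl⟩
  · obtain ⟨⟨a, rfl⟩, ⟨b, rfl⟩⟩ := D.coord_mem_range_of_torsion_two_mul_l h hQ
    have h₀ : (E.baseChange K).toAffine.Nonsingular a b :=
      (E.toAffine.baseChange_nonsingular (f := IsScalarTower.toAlgHom F K Fbar)
        (fun _ _ e => (algebraMap K Fbar).injective e) a b).mp h
    exact ⟨Affine.Point.some a b h₀, rfl⟩

end InitialThetaData

end Global

end Literature.IUT.HodgeTheaters

end
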